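import Mathlib.Algebra.MvPolynomial.Basic
import Mathlib.Data.Finset.Sort
import Mathlib.Data.Finsupp.Basic
import Mathlib.Logic.Encodable.Pi
import Literature.Computability.Complexity.BoolEncodings
import HarnessLib

/-!
# Coefficient definability of integer polynomial families in a Boolean complexity class

The *coefficient function* of a family `P = (Pₙ)` of multivariate polynomials with integer
coefficients (Koiran–Perifel, MFCS 2007, Def. 1): on input `(n, e, j)` it returns the `j`-th bit
of the coefficient of the monomial `x^e` in `Pₙ`, and on `(n, e, 0)` its sign; "the coefficient
function is a function `{0,1}* → {0,1}` and can therefore be viewed as a language. This allows us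
to speak of the complexity of the coefficient function" (loc. cit.). Bürgisser (ECCC TR06-113,
Def. 3.1) phrases the same data for integer *sequences* `a(n, k)` as two languages, the sign
language `Sgn(a) = {(n,k) | a(n,k) ≥ 0}` and the bit language
`Bit(|a|) = {(n,k,j,b) | the j-th bit of |a(n,k)| is b}`, indices in binary, together with a
polynomial bitsize bound; that notion is the tree's
`Literature.Computability.AlgebraicComplexity.IsDefinableIn` (`TauConjectureProofs.lean`).

This file provides the **exponent-indexed analogue** for polynomial families
`P : ∀ n, MvPolynomial (σ n) ℤ` over encodable variable types, with the class of languages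
`K : Set (Language Bool)` as a parameter (instances of interest: `K = CH`, `K = CH/poly`,
`K = PSPACE` — Koiran–Perifel's `Uniform VPSPACE⁰` requirement (5) —, `K = P/poly`):

* `sparseList f` — the sparse code of `f : ℕ →₀ ℕ` as the increasing list of pairs `(c, f c)`,
  `c ∈ supp f` (injective; private lemma);
* `encMonomial e` — the binary string of a monomial `e : σ →₀ ℕ`: transport the variables along
  `Encodable.encode : σ → ℕ`, then encode the sparse list of (variable code, exponent) pairs with
  the tree's `Bool` encodings (`encodingNatBool.pairBool encodingNatBool).listBool`
  (`encMonomial_injective`);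
* `encCoeffIdx n e = ⟨bin n, encMonomial e⟩`, `encCoeffBitQuery n e j b = ⟨⟨bin n, encMonomial e⟩, ⟨bin j, [b]⟩⟩`
  (the shapes of `encIdx`/`encBitQuery` of `TauConjectureProofs.lean` with the monomial in place
  of the index `k`), both injective;
* `HasPolyCoeffBitsize P` — `∃ c, ∀ n > 1, ∀ e, |coeff e Pₙ| ≤ 2^{n^c}` (Bürgisser's condition (4);
  Koiran–Perifel Def. 2 (3));
* `coeffSignLang P`, `coeffBitLang P` — the canonical sign and bit languages of the family;
* `IsCoeffDefinableIn K P` — polynomial bitsize, and some language in `K` agrees with the sign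
  predicate on all index codes, and some language in `K` agrees with the bit predicate on all bit
  queries (the `∃ S ∈ K` phrasing of `IsDefinableIn`, which leaves the languages unconstrained off
  the code words);
* API: `IsCoeffDefinableIn.mono` (monotone in `K`), `IsCoeffDefinableIn.of_mem` (the canonical
  languages witness the definition), `IsCoeffDefinableIn.hasPolyCoeffBitsize`.

## Design notes

* The p-family side conditions (polynomially many variables, p-bounded degree) are deliberately
  NOT part of `IsCoeffDefinableIn`; they are `IsPFamily` (`ValiantClasses.lean`) and are imposed
  separately by users (e.g. in Valiant's criterion).
* Sparse versus dense exponent vectors: Koiran–Perifel encode `x^α` by the dense vector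
  `α = (α₁, …, αₙ)` in binary; for a general encodable variable type the sparse list of
  (variable code, exponent) pairs is the natural choice. For p-families the two codes are
  polynomial-time inter-convertible, so membership in any class closed under polynomial-time
  many-one reductions is unaffected; we do not formalise this remark.
* No `DecidableEq`/`Fintype` hypotheses are needed: `Finsupp.support` is a `Finset` and the
  variable codes are sorted in `ℕ`. `Mathlib.Logic.Encodable.Pi` is imported so that variable types
  such as `Fin 3 → Fin q` (`Encodable.finArrow`) are covered out of the box.

## References

* P. Koiran, S. Perifel, *VPSPACE and a transfer theorem over the complex field*, MFCS 2007,
  LNCS 4708, 359–370, Def. 1 (coefficient function), Def. 2 (Uniform VPSPACE⁰). Key `KoiranPerifel2007`.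
* P. Bürgisser, *On defining integers in the counting hierarchy and proving lower bounds in
  algebraic complexity*, ECCC TR06-113 (= Comput. Complexity 18 (2009)), Def. 3.1. Key `Burgisser2006`.
-/

noncomputable section

open MvPolynomial

namespace Literature.Computability.AlgebraicComplexity

open _root_.Computability Literature.Computability.Complexity

/-! ### Binary codes of monomials -/

/-- The sparse code of a finitely supported `f : ℕ →₀ ℕ`: the list of pairs `(c, f c)` over the
support of `f`, in increasing order of `c` (the "sparse representation" of an exponent vector,
variable codes in increasing order). [folklore] -/
def sparseList (f : ℕ →₀ ℕ) : List (ℕ × ℕ) :=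
  (f.support.sort (· ≤ ·)).map fun c => (c, f c)

/-- A pair belongs to the sparse code of `f` iff it belongs to the graph of `f`
(`Finsupp.graph`: pairs `(c, f c)` with `f c ≠ 0`); private plumbing for `encMonomial_injective`. [folklore] -/
private theorem mem_sparseList_iff {f : ℕ →₀ ℕ} {p : ℕ × ℕ} : p ∈ sparseList f ↔ p ∈ f.graph := by
  rw [sparseList, List.mem_map, Finsupp.mem_graph_iff]
  constructor
  · rintro ⟨c, hc, rfl⟩
    exact ⟨rfl, by simpa only [Finset.mem_sort, Finsupp.mem_support_iff] using hc⟩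
  · rintro ⟨h1, h2⟩
    refine ⟨p.1, by simpa only [Finset.mem_sort, Finsupp.mem_support_iff, h1] using h2, ?_⟩
    rw [h1]

/-- The sparse code determines the function; private plumbing for `encMonomial_injective`. [folklore] -/
private theorem sparseList_injective : Function.Injective sparseList := by
  intro f g h
  refine Finsupp.graph_inj.1 (Finset.ext fun p => ?_)
  rw [← mem_sparseList_iff, ← mem_sparseList_iff, h]

/-- Binary encoding is injective (Mathlib's `decode_encodeNat`). [folklore] -/
private theorem encodeNat_injective' : Function.Injective encodeNat := fun a b h => by
  simpa only [decode_encodeNat] using congr_arg decodeNat h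

/-- Componentwise injectivity of the pairing `boolPair` (from `boolPair_injective`). [folklore] -/
private theorem boolPair_inj_iff {x y x' y' : List Bool} :
    boolPair x y = boolPair x' y' ↔ x = x' ∧ y = y' := by
  constructor
  · intro h
    have := boolPair_injective (a₁ := (x, y)) (a₂ := (x', y')) (by simpa [Function.uncurry] using h)
    exact Prod.mk.inj this
  · rintro ⟨rfl, rfl⟩
    rfl

section Monomial

variable {σ : Type*} [Encodable σ]

/-- **Binary code of a monomial** `x^e`, `e : σ →₀ ℕ`: transport the variables to `ℕ` along
`Encodable.encode`, and encode the resulting sparse list of (variable code, exponent) pairs, all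
naturals in binary, with the tree's self-delimiting `Bool` encodings (Koiran–Perifel 2007, before
Def. 1: "a monomial `x₁^{α₁} ⋯ xₙ^{αₙ}` is encoded in binary by `α = (α₁, …, αₙ)`"; here in sparse
form, see the module docstring). [cite: KoiranPerifel2007, Def. 1] -/
def encMonomial (e : σ →₀ ℕ) : List Bool :=
  (encodingNatBool.pairBool encodingNatBool).listBool.encode (sparseList (e.mapDomain Encodable.encode))

/-- Distinct monomials have distinct codes. [cite: KoiranPerifel2007, Def. 1] -/
theorem encMonomial_injective : Function.Injective (encMonomial (σ := σ)) := fun _ _ h =>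
  Finsupp.mapDomain_injective Encodable.encode_injective
    (sparseList_injective ((Encoding.encode_injective _) h))

/-- Binary code of the coefficient index `(n, e)`: `⟨bin n, encMonomial e⟩` (the analogue of
`encIdx n k` of Bürgisser's Def. 3.1 with the monomial in place of `k`). [cite: Burgisser2006, Def. 3.1] -/
def encCoeffIdx (n : ℕ) (e : σ →₀ ℕ) : List Bool :=
  boolPair (encodeNat n) (encMonomial e)

/-- Binary code of the bit query `(n, e, j, b)`: `⟨⟨bin n, encMonomial e⟩, ⟨bin j, [b]⟩⟩` (the
analogue of `encBitQuery n k j b` of Bürgisser's Def. 3.1). [cite: Burgisser2006, Def. 3.1] -/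
def encCoeffBitQuery (n : ℕ) (e : σ →₀ ℕ) (j : ℕ) (b : Bool) : List Bool :=
  boolPair (encCoeffIdx n e) (boolPair (encodeNat j) [b])

/-- The index code is injective in `(n, e)`. [cite: Burgisser2006, Def. 3.1] -/
theorem encCoeffIdx_inj {n n' : ℕ} {e e' : σ →₀ ℕ} :
    encCoeffIdx n e = encCoeffIdx n' e' ↔ n = n' ∧ e = e' := by
  refine ⟨fun h => ?_, by rintro ⟨rfl, rfl⟩; rfl⟩
  obtain ⟨h1, h2⟩ := boolPair_inj_iff.1 h
  exact ⟨encodeNat_injective' h1, encMonomial_injective h2⟩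

/-- The bit-query code is injective in `(n, e, j, b)`. [cite: Burgisser2006, Def. 3.1] -/
theorem encCoeffBitQuery_inj {n n' j j' : ℕ} {e e' : σ →₀ ℕ} {b b' : Bool} :
    encCoeffBitQuery n e j b = encCoeffBitQuery n' e' j' b' ↔ n = n' ∧ e = e' ∧ j = j' ∧ b = b' := by
  refine ⟨fun h => ?_, by rintro ⟨rfl, rfl, rfl, rfl⟩; rfl⟩
  obtain ⟨h1, h2⟩ := boolPair_inj_iff.1 h
  obtain ⟨h3, h4⟩ := boolPair_inj_iff.1 h2
  obtain ⟨rfl, rfl⟩ := encCoeffIdx_inj.1 h1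
  exact ⟨rfl, rfl, encodeNat_injective' h3, by simpa using h4⟩

end Monomial

/-! ### Coefficient definability of a family -/

section Family

variable {σ : ℕ → Type*}

/-- **Polynomial bitsize of the coefficients**: there is a constant `c` with
`|coeff_e(Pₙ)| ≤ 2^{n^c}` for all `n > 1` and all monomials `e` (Bürgisser, ECCC TR06-113, §3 (4),
for sequences; Koiran–Perifel 2007, Def. 2 (3): "the size of the coefficients of `fₙ` is bounded by
`2^{p(n)}`"). The guard `1 < n` is Bürgisser's. [cite: Burgisser2006, §3 (4)] -/
def HasPolyCoeffBitsize (P : ∀ n, MvPolynomial (σ n) ℤ) : Prop :=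
  ∃ c : ℕ, ∀ n, 1 < n → ∀ e : σ n →₀ ℕ, |coeff e (P n)| ≤ 2 ^ (n ^ c)

variable [∀ n, Encodable (σ n)]

/-- The **sign language** of the family `P`: the codes `⟨bin n, encMonomial e⟩` of the pairs
`(n, e)` with `coeff_e(Pₙ) ≥ 0` (Koiran–Perifel 2007, Def. 1: `a(n, α, 0)` is the sign of the
coefficient; Bürgisser's `Sgn`). [cite: KoiranPerifel2007, Def. 1] -/
def coeffSignLang (P : ∀ n, MvPolynomial (σ n) ℤ) : Language Bool :=
  {w | ∃ (n : ℕ) (e : σ n →₀ ℕ), w = encCoeffIdx n e ∧ 0 ≤ coeff e (P n)}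

/-- The **bit language** of the family `P`: the codes of the quadruples `(n, e, j, b)` such that
the `j`-th bit of `|coeff_e(Pₙ)|` is `b` (Koiran–Perifel 2007, Def. 1: `a(n, α, i)` is the `i`-th
bit of the coefficient of `x^α` in `fₙ`; Bürgisser's `Bit(|a|)`; bits indexed from `0` as in
`Nat.testBit`). [cite: KoiranPerifel2007, Def. 1] -/
def coeffBitLang (P : ∀ n, MvPolynomial (σ n) ℤ) : Language Bool :=
  {w | ∃ (n : ℕ) (e : σ n →₀ ℕ) (j : ℕ) (b : Bool),
    w = encCoeffBitQuery n e j b ∧ (coeff e (P n)).natAbs.testBit j = b}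

/-- **Coefficient definability of an integer polynomial family in a class `K` of languages**
(the exponent-indexed analogue of Bürgisser's Def. 3.1 `IsDefinableIn`, with the semantics of
Koiran–Perifel's coefficient function, Def. 1–2): `P = (Pₙ)` has coefficients of polynomial
bitsize, some language of `K` agrees with the sign predicate `coeff_e(Pₙ) ≥ 0` on every index
code `⟨bin n, encMonomial e⟩`, and some language of `K` agrees with the bit predicate
"bit `j` of `|coeff_e(Pₙ)|` is `b`" on every bit-query code. With `K = PSPACE` the last two
clauses say "the coefficient function of `(Pₙ)` is in `PSPACE`" (Koiran–Perifel, Def. 2 (5));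
the number-of-variables and degree requirements of a p-family are NOT included here
(see the module docstring). [cite: KoiranPerifel2007, Def. 1–2] -/
def IsCoeffDefinableIn (K : Set (Language Bool)) (P : ∀ n, MvPolynomial (σ n) ℤ) : Prop :=
  HasPolyCoeffBitsize P ∧
    (∃ S ∈ K, ∀ (n : ℕ) (e : σ n →₀ ℕ), encCoeffIdx n e ∈ S ↔ 0 ≤ coeff e (P n)) ∧
    ∃ B ∈ K, ∀ (n : ℕ) (e : σ n →₀ ℕ) (j : ℕ) (b : Bool),
      encCoeffBitQuery n e j b ∈ B ↔ (coeff e (P n)).natAbs.testBit j = b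

/-- A coefficient-definable family has coefficients of polynomial bitsize (first clause). [cite: KoiranPerifel2007, Def. 2] -/
theorem IsCoeffDefinableIn.hasPolyCoeffBitsize {K : Set (Language Bool)}
    {P : ∀ n, MvPolynomial (σ n) ℤ} (h : IsCoeffDefinableIn K P) : HasPolyCoeffBitsize P :=
  h.1

/-- Coefficient definability is monotone in the class (immediate; used with `CH ⊆ CH/poly`,
`P ⊆ PSPACE`, …). [cite: Burgisser2006, Def. 3.1] -/
theorem IsCoeffDefinableIn.mono {K K' : Set (Language Bool)} (hKK' : K ⊆ K')
    {P : ∀ n, MvPolynomial (σ n) ℤ} (h : IsCoeffDefinableIn K P) : IsCoeffDefinableIn K' P := by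
  obtain ⟨hb, ⟨S, hS, hS'⟩, ⟨B, hB, hB'⟩⟩ := h
  exact ⟨hb, ⟨S, hKK' hS, hS'⟩, ⟨B, hKK' hB, hB'⟩⟩

/-- The index code `⟨bin n, encMonomial e⟩` lies in the sign language iff the coefficient is
nonnegative (by injectivity of the code). [cite: KoiranPerifel2007, Def. 1] -/
theorem encCoeffIdx_mem_coeffSignLang_iff (P : ∀ n, MvPolynomial (σ n) ℤ) (n : ℕ) (e : σ n →₀ ℕ) :
    encCoeffIdx n e ∈ coeffSignLang P ↔ 0 ≤ coeff e (P n) := by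
  refine ⟨?_, fun h => ⟨n, e, rfl, h⟩⟩
  rintro ⟨n', e', hw, h⟩
  obtain ⟨h1, h2⟩ := boolPair_inj_iff.1 hw
  obtain rfl := encodeNat_injective' h1
  obtain rfl := encMonomial_injective h2
  exact h

/-- The bit-query code of `(n, e, j, b)` lies in the bit language iff bit `j` of
`|coeff_e(Pₙ)|` is `b` (by injectivity of the code). [cite: KoiranPerifel2007, Def. 1] -/
theorem encCoeffBitQuery_mem_coeffBitLang_iff (P : ∀ n, MvPolynomial (σ n) ℤ) (n : ℕ)
    (e : σ n →₀ ℕ) (j : ℕ) (b : Bool) :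
    encCoeffBitQuery n e j b ∈ coeffBitLang P ↔ (coeff e (P n)).natAbs.testBit j = b := by
  refine ⟨?_, fun h => ⟨n, e, j, b, rfl, h⟩⟩
  rintro ⟨n', e', j', b', hw, h⟩
  obtain ⟨h1, h2⟩ := boolPair_inj_iff.1 hw
  obtain ⟨h3, h4⟩ := boolPair_inj_iff.1 h1
  obtain rfl := encodeNat_injective' h3
  obtain rfl := encMonomial_injective h4
  obtain ⟨h5, h6⟩ := boolPair_inj_iff.1 h2
  obtain rfl := encodeNat_injective' h5
  obtain rfl : b = b' := by simpa using h6
  exact h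

/-- **The canonical witnesses**: if the coefficients have polynomial bitsize and the sign and bit
languages of `P` themselves belong to `K`, then `P` is coefficient-definable in `K` (this is the
literal reading of Koiran–Perifel's "the coefficient function of `(fₙ)` is in PSPACE", Def. 2 (5),
for `K = PSPACE`). [cite: KoiranPerifel2007, Def. 2] -/
theorem IsCoeffDefinableIn.of_mem {K : Set (Language Bool)} {P : ∀ n, MvPolynomial (σ n) ℤ}
    (hb : HasPolyCoeffBitsize P) (hS : coeffSignLang P ∈ K) (hB : coeffBitLang P ∈ K) :
    IsCoeffDefinableIn K P :=
  ⟨hb, ⟨coeffSignLang P, hS, encCoeffIdx_mem_coeffSignLang_iff P⟩,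
    ⟨coeffBitLang P, hB, encCoeffBitQuery_mem_coeffBitLang_iff P⟩⟩

end Family

end Literature.Computability.AlgebraicComplexity

end
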